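import Summits.CriticalPhenomena.PercolationContinuityZ3.Theorems.PercNearOneGluingNoHeavyLowerTailSahiLatinBridge4
import Summits.CriticalPhenomena.PercolationContinuityZ3.Theorems.PercNearOneGluingNoHeavyLowerTailSahiLatinThree

/-!
# `NoHeavyLowerTail` (crux stmt-CriticalPhenomena-4575), Sahi programme (prim-master-conj gen 42): `E₄` ON PRODUCTS OF THREE CHAINS ⟸
# terminal positivity of `[4]³` — the `n = 4`, `D = 3` rung of the ladder assembled in the kernel

Support file (`--supports stmt-CriticalPhenomena-4575`; COMPUTATIONAL through `…SahiLatinThree`'s imported certificate).  Memo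
`run/shared/lean/prim/prim-l12/FROM-prim-master-conj-g41-DESCENT.md` §10, §10d.

`LatinPos (Fin 3)` (FBP(3,3), kernel-checked: `SahiLatin.latinPos_fin_three`) discharges the order-3 hypothesis of the order-4 ladder, so:
* `latinPos4_fin_three_iff` — FBP(4,3) ⟺ `TerminalPos4 (Fin 3)`;
* **`sahiPositive_four_pi_fin_three_of_terminalPos4`** — if `K₄ ≥ 0` on the terminal up-set 4-tuples of `[4]³` (a finite statement;
  enumerated OUTSIDE Lean by gen 41: 761 288 011 terminal 4-tuples, minimum `576` on the hard ones, `0` negative — memo §10d, not a kernel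
  fact), then Sahi's `E₄(f₁,…,f₄) ≥ 0` for all nonnegative monotone `fᵢ` on every product `Π_{i : Fin 3} α_i` of THREE finite linear orders
  under every product probability weight.  In print `E₄ ≥ 0` is known on products of TWO chains / `[0,1]²` [LiebSahi2022, Thm 3.7].
Everything here is proved; axioms standard (+ `Lean.ofReduceBool` via the imported certificate).
-/

namespace Summit.CriticalPhenomena.PercolationContinuityZ3.Theorems.SahiLatin

open Finset Literature.Combinatorics.Sahi2008

/-- **FBP(4,3) ⟺ terminal positivity of `[4]³`** (the order-3 input is the tree theorem `latinPos_fin_three`). [this work] -/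
theorem latinPos4_fin_three_iff : LatinPos4 (Fin 3) ↔ TerminalPos4 (Fin 3) := latinPos4_iff_terminalPos4 latinPos_fin_three

/-- **`E₄ ≥ 0` on every product of THREE finite linear orders, every product probability weight, GIVEN terminal positivity of `[4]³`.**
[this work] -/
theorem sahiPositive_four_pi_fin_three_of_terminalPos4 (hT : TerminalPos4 (Fin 3)) {α : Fin 3 → Type*} [∀ i, Fintype (α i)]
    [∀ i, LinearOrder (α i)] (w : ∀ i, α i → ℝ) (hw : ∀ i x, 0 ≤ w i x) (hw1 : ∀ i, ∑ x, w i x = 1) :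
    SahiPositive (fun p : (∀ i, α i) => ∏ i, w i (p i)) 4 :=
  sahiPositive_four_of_terminalPos4 latinPos_fin_three hT w hw hw1

end Summit.CriticalPhenomena.PercolationContinuityZ3.Theorems.SahiLatin
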